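import Summits.FinalStateConjecture.FinalStateConjecture.Theses.PhaseMixingCapture
import Literature.Geometry.Lorentzian.KerrCombinedCurrent
import Literature.Geometry.Lorentzian.KerrTortoiseRadius
import Literature.Geometry.Lorentzian.KerrSurfaceGravity
import Literature.Geometry.Lorentzian.TeukolskyWronskianBound

/-!
# Line `extremal-corner-blowup` for crux `PhaseMixingCapture.KappaExplicitWaveDecay` (stmt-FinalStateConjecture-10654)

Skeleton (crux-plan, `planner-cruxplan-stmt-FinalStateConjecture-10654-extremal-corner-blow-0`, 2026-08-16).
Route `route-FinalStateConjecture-PhaseMixingCapture` (rank-3 crux); idea card `extremal-corner-blowup`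
(ideator `cruxidea-stmt-FinalStateConjecture-10654-1`, round 1; triage r1-1: pass, "merge ≈ blow-up-the-throat,
keep the h-uniform Transfer"). POSITIVE line: the composition `KappaExplicitWaveDecay_of` concludes the crux
decl BY NAME from the six registered stub statements; `KappaExplicitWaveDecay_proof` applies it to the sorried
stubs (so the audit lists exactly the sorries the crux depends on along this line).

## The crux (recall)

`KappaExplicitWaveDecay`: for every `M > 0` there are `p`, `j` with (a) `sliceEnergy(ψ, τ) ≤ C(M)·χ^{-p}·E_j[ψ](0)`
for all `τ ≥ 0` and (b) `∫₀^∞ E_loc(τ, R) dτ ≤ C(M, R)·χ^{-p}·E_j[ψ](0)`, for EVERY sub-extremal spin `|a| < M` and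
every admissible wave `ψ` (smooth solution of `□_{g_{M,a}} ψ = 0` on `{r > r₊}` with compactly supported data on
`{t* = 0}`), `χ = 1 − (a/M)²` (`κM ∈ [√χ/4, √χ/2]`, `Kerr.mul_surfaceGravity_mem_Icc`: "power of κ" = "power of
χ"). I.e. Dafermos–Rodnianski–Shlapentokh-Rothman III (arXiv:1402.7034, Thms 3.1/3.2) with constants that are
EXPLICIT POWERS of the surface gravity `κ = Kerr.surfaceGravity M a` instead of "blowing up as a₀ → M" (their
p. 16; the superradiant `ε` lost at threshold, p. 7; the `α`-smallness of Lemma 6.4.1 degenerating, p. 24).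

## The line (lever: quasi-homogeneous blow-up of the threshold corner)

Everything in DRSR's proof is uniform in `a ≤ M` EXCEPT the corner `{κ → 0} × {ω → mω₊} × {|m| → ∞}` of
frequency space: at bounded frequencies Teixeira da Costa's quantitative mode stability (arXiv:1910.02854,
Prop. 6.3; tree: named fact `Kerr.Costa2019_wronskianBound_subextremal`) is already uniform in `|a| < M`
INCLUDING the thresholds `ω = mω₊(a)`, and off the threshold cone `|ω − mω₊| ≥ ε₀|m|` the margins of DRSR §6/§8
(`ω² − V(r₊) = (ω − ω₊m)²`, `V₀(r⁰_max) − ω²`) do not see `κ`. The lever of the card: blow up the corner in the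
scaling `x = (r − r₊)/(r₊ − r₋)`, `ξ = (ω − mω₊)/(2κ)` (`= i·Kerr.horizonExponent`). The scalar radial ODE becomes,
EXACTLY (no limit taken; `stub_blowupNormalForm`, the kernel of the card's `radialK_rescale`),
`x(x+1)R″ + (2x+1)R′ + ( [ξ + ωx(2r₊ + (r₊−r₋)x)]²/(x(x+1)) − λ − a²ω² + 2amω ) R = 0`, whose `κ → 0` limit at
fixed `(x, ξ, m, λ)` is the near-NHEK operator AT UNIT SURFACE GRAVITY
`x(x+1)R″ + (2x+1)R′ + ((ξ + mx)²/(x(x+1)) − λ + 3m²/4)R = 0` (hypergeometric; exponents `x^{∓iξ}` at the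
horizon `x = 0`, `x^{−1/2 ± √(λ + 1/4 − 7m²/4)}` at `x = ∞`, Yang et al. arXiv:1212.3271): a `κ`-FREE front face
on which the red-shift (`κ̂ = 1`), the superradiant non-trapping margin (`O(1)` in `ξ/m`, triage T2:
`(Ω_orb − Ω_H)/κ → 0.134 = 2ξ̃_trap`) and the in-throat trapping (`x₀ ≥ 0.077`, Lyapunov exponent `= κ`, i.e. `1`
in blown-up time) are all NON-degenerate. The line proves DRSR's frequency-localised estimate (their Theorem 8.1)
in the cone ONCE on the resolved space, uniformly in `h = 1/|m|` and in the matching variable `ξ/m → ∞`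
(`stub_coneEstimate`, HARDEST, the card's Transfer `C⁺` as sharpened by triage r1-1), reads the `κ`-dependence off
the change of units (powers of `κ` from `dt* = dt̂/κ`, `dr* = dx/(2κ x(x+1)) + …`), keeps DRSR verbatim with
tracked constants off the cone (`stub_offConeEstimate`) and on bounded boxes (`stub_boxWronskian` = TdC Prop. 6.3
for `s = 0`), and runs DRSR §§9–13 (cut-off, Carter separation, summation, red-shift of strength `∝ κ`, large-`r`
currents, higher order, boundedness) with the constants tracked (`stub_integratedDecay`, `stub_boundedness`).

    KappaExplicitWaveDecay  ⇐  (∃ p j, (a)) ∧ (∃ p j, (b))      [`_of`: p, j ↦ max; χ^{-p}, E_j monotone]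
      (b) = stub_integratedDecay (CONE) (OFFCONE) (BOX)          [DRSR §§9–12 κ-explicit]
      (a) = stub_boundedness   (CONE) (OFFCONE) (BOX) (b)        [DRSR §13 κ-explicit]
      CONE    = stub_coneEstimate (stub_blowupNormalForm)         [blow-up: front face × far face × matching]
      OFFCONE = stub_offConeEstimate                              [DRSR Thm 8.1 off the cone, constants tracked]
      BOX     = stub_boxWronskian                                 [= Kerr.Costa2019_wronskianBound_subextremal, s = 0]

All six stubs are stated over IMPORTABLE tree vocabulary only (TdC: `Kerr.IsRadialTeukolskySolution`,
`Kerr.IsNormalisedHorizon/InfinitySolution`, `Kerr.radialWronskian`; DRSR §§5–8 as formalised in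
`KerrSeparatedPotential` / `KerrTortoiseRadius` / `KerrCombinedCurrent`: `Kerr.IsAdmissibleTriple`,
`Kerr.sepPotential`, `Kerr.IsTortoiseRadius`, `Kerr.Multipliers` (+ `HasDerivs`, `EndLimits`),
`Kerr.OutgoingBoundary`, `Kerr.combinedSource`; `Kerr.surfaceGravity`, `Kerr.horizonAngularVelocity`; and the
crux's own physical-space clauses verbatim), so a stub proof can be landed under `Theorems/` with the registered
signature copied word for word. The abbreviations `Statement.stub_…` below are just NAMES for the six statements
(`type_of%` of the stub theorems), used as the hypotheses of `KappaExplicitWaveDecay_of`.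

## Disproof used

None exists for this crux at planning time: `payload.disproof_path`
(`run/sessions/refuter-cdisprove-stmt-FinalStateConjecture-10654-0/folder/Disproof.lean`) is not mounted in this
jail and `Cruxes/KappaExplicitWaveDecay/Disproof.lean` has not been crux-written (`ledger crux ls`: Ideas ×3 +
TRIAGE-r1-1 only); no `_false_without_` theorem, no `Theorems/KappaExplicitWaveDecay/Negative/` lemma; `ledger
negatives --problem FinalStateConjecture`: 0. Honoured instead, from the refuter's crux-attack note on the item
(rattack-10654, 2026-08-15): (i) the `IsSubextremal` guard is load-bearing — every frequency-side stub keeps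
`κ > 0` (`Kerr.IsSubextremal M a`) and lets constants degenerate like `κ^{-N}`; nothing is claimed at `|a| = M`
(Aretakis/Gajic growth lives there); (ii) `j ≥ 2` (Sbierski): the LHS weight `(1 − r_trap/r)²(ω² + Λ) + 1` of
the phase-space stubs is DRSR's trapping-degenerate one, so (b) is only claimed with derivative loss; (iii) `p ≥ 1/2`
heuristic — the stubs only assert SOME power `N`.
-/

set_option linter.unusedVariables false
set_option linter.dupNamespace false
set_option linter.unreachableTactic false
set_option linter.unusedTactic false

namespace Summit.FinalStateConjecture.FinalStateConjecture.Cruxes.KappaExplicitWaveDecay.ExtremalCornerBlowup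

open Summit.FinalStateConjecture.FinalStateConjecture.Theses.PhaseMixingCapture
open Literature.Geometry.Lorentzian
open MeasureTheory Filter Set
open scoped Topology Manifold ENNReal InnerProductSpace ComplexConjugate Classical

/-! ## The six registered stubs -/

/-- **S1 · `stub_blowupNormalForm` — the front face exists (exact conjugation + its `κ → 0` limit).**
(i) For `M > 0`, `|a| < M`, real `m, λ, ξ` and ANY `R : ℝ → ℂ`: `R` solves the homogeneous scalar (`s = 0`) radial
Teukolsky ODE (`Kerr.IsRadialTeukolskySolution`, TdC §2.2.3: `ΔR″ + 2(r−M)R′ + (K²/Δ − λ − a²ω² + 2amω)R = 0`) at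
the frequency `ω = mω₊ + 2κξ` iff `S(x) := R(r₊ + (r₊ − r₋)x)` solves on `x > 0` the BLOWN-UP equation
`x(x+1)S″ + (2x+1)S′ + ([ξ + ωx(2r₊ + (r₊−r₋)x)]²/(x(x+1)) − λ − a²ω² + 2amω)S = 0` — termwise:
`Δ = (r₊−r₋)²x(x+1)`, `2(r−M) = (r₊−r₋)(2x+1)` (`r₊ − M = (r₊−r₋)/2`), `K = ω(r²+a²) − am = (r₊−r₋)(ξ + ωx(2r₊ + (r₊−r₋)x))`
(`K(r₊) = (r₊²+a²)(ω − mω₊) = (r₊−r₋)ξ` as `κ = (r₊−r₋)/(2(r₊²+a²))`, `ω₊ = a/(r₊²+a²)`), the card's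
`radialK_rescale`, kernel-checked by the ideator and by triage (A1)–(A2). (ii) The coefficients converge to the
near-NHEK₁ ones as `a ↑ M` at fixed `(x, ξ, m, λ)`: `ω·x·(2r₊ + (r₊−r₋)x) → m x` and
`−λ − a²ω² + 2amω → −λ + 3m²/4` (`ω → m/(2M)`, `r₊ → M`, `κ → 0`; triage (A3)–(A4)).
Why true: pure calculus — affine change of variable in `HasDerivAt` (both directions, `r₊ − r₋ = 2√(M²−a²) > 0`,
`Kerr.rPlus_sub_rMinus`), the two polynomial identities, and continuity of `rPlus`, `rMinus`, `surfaceGravity`,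
`horizonAngularVelocity` in `a` at `a = M` (`Kerr.surfaceGravity_eq_zero_iff`, `Kerr.rPlus_sub_self`).
Leans on: `Kerr.IsRadialTeukolskySolution`, `Kerr.radialK`, `Kerr.delta_eq_mul` / `Kerr.delta` (Sweep2),
`Kerr.rPlus_sq_add_sq`, `Kerr.surfaceGravity_eq_rPlus_sub_rMinus_div`, `Kerr.horizonAngularVelocity`. Size M.
Used by: `stub_coneEstimate` (its hypothesis). -/
theorem stub_blowupNormalForm :
    (∀ (M a m lam ξ : ℝ), 0 < M → |a| < M → ∀ R : ℝ → ℂ,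
        (Kerr.IsRadialTeukolskySolution M a 0 (m * Kerr.horizonAngularVelocity M a + 2 * Kerr.surfaceGravity M a * ξ) m lam R ↔
          ∃ S' S'' : ℝ → ℂ, ∀ x : ℝ, 0 < x →
            HasDerivAt (fun y : ℝ ↦ R (Kerr.rPlus M a + (Kerr.rPlus M a - Kerr.rMinus M a) * y))
                (S' x) x ∧
              HasDerivAt S' (S'' x) x ∧
              ((x * (x + 1) : ℝ) : ℂ) * S'' x + ((2 * x + 1 : ℝ) : ℂ) * S' x +
                  (((ξ + (m * Kerr.horizonAngularVelocity M a + 2 * Kerr.surfaceGravity M a * ξ) * x * (2 * Kerr.rPlus M a + (Kerr.rPlus M a - Kerr.rMinus M a) * x)) ^ 2 /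
                          (x * (x + 1)) -
                        lam - a ^ 2 * (m * Kerr.horizonAngularVelocity M a + 2 * Kerr.surfaceGravity M a * ξ) ^ 2 + 2 * a * m * (m * Kerr.horizonAngularVelocity M a + 2 * Kerr.surfaceGravity M a * ξ) : ℝ) : ℂ) *
                    R (Kerr.rPlus M a + (Kerr.rPlus M a - Kerr.rMinus M a) * x) = 0)) ∧
      (∀ (M m ξ x : ℝ), 0 < M →
        Tendsto (fun b : ℝ ↦ (m * Kerr.horizonAngularVelocity M b + 2 * Kerr.surfaceGravity M b * ξ) * x * (2 * Kerr.rPlus M b + (Kerr.rPlus M b - Kerr.rMinus M b) * x))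
          (𝓝[<] M) (𝓝 (m * x))) ∧
      (∀ (M m lam ξ : ℝ), 0 < M →
        Tendsto (fun b : ℝ ↦ -lam - b ^ 2 * (m * Kerr.horizonAngularVelocity M b + 2 * Kerr.surfaceGravity M b * ξ) ^ 2 + 2 * b * m * (m * Kerr.horizonAngularVelocity M b + 2 * Kerr.surfaceGravity M b * ξ)) (𝓝[<] M)
          (𝓝 (-lam + 3 * m ^ 2 / 4))) := by
  sorry

/-- **S2 · `stub_coneEstimate` — HARDEST, load-bearing: DRSR's frequency-localised estimate (Theorem 8.1 of
arXiv:1402.7034) in the THRESHOLD CONE `m ≠ 0`, `|ω − mω₊| ≤ ε₀|m|`, with constants that are explicit powers of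
`κ = Kerr.surfaceGravity M a`, uniformly on the whole sub-extremal range.** Given the normal form S1 (hypothesis,
stated verbatim), for every `M > 0`, window parameters `θ > 0` (inner edge `r ≥ r₊ + θ(r₊ − r₋)`, i.e. blown-up
depth `x ≥ θ` — the red-shift of the unit-temperature front face owns `x ≤ θ`) and `Θ` (outer edge), there are an
exponent `N`, a cone aperture `ε₀ > 0`, constants `b, B, ωl, ωh, Λh` depending on `(M, θ, Θ)` ONLY, such that for
every `|a| < M`, every tortoise radius function `R` (`Kerr.IsTortoiseRadius`), every admissible triple
(`Kerr.IsAdmissibleTriple`, DRSR Def. 6.1.1) in the cone there are multipliers `μ = (f, h, y, χ₁, χ₂)`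
(`Kerr.Multipliers`, with `HasDerivs`, `EndLimits` at both ends, sup bounds `≤ Bκ^{-N}` incl. DRSR's `Δ⁻¹r²|f′|`,
the far structure "`f + y = 1` up to `Be^{−bκ^N(x−X)}`, `f′ = h = χ₁ = 0`, `χ₂ = 1` beyond `X`, `R(X) ≤ B`", a
parameter `0 ≤ E ≤ Bκ^{-N}` and a trapping radius `r_trap ∈ {0} ∪ [r₊ + bκ^N, B]`) such that every smooth solution
of Carter's inhomogeneous radial ODE `u″ + (ω² − V(R(x)))u = H` (`V = Kerr.sepPotential`) with DRSR's outgoing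
boundary behaviour (`Kerr.OutgoingBoundary ω (ω − ω₊m) V u u′ A_∞ A_𝓗`, (eq:b±) of §5.3) satisfies
`bκ^N ∫_{x₁}^{x₂} (|u′|² + ((1 − r_trap/r)²(ω² + Λ) + 1)|u|²) ≤ ∫ H·(f,h,y,χ)·(u,u′) + 1_{ωl ≤ |ω| ≤ ωh, Λ ≤ Λh}·Bκ^{-N}·A_𝓗`
(`Kerr.combinedSource`; `A_𝓗 = |u(−∞)|²`) on every window `[x₁, x₂]` with `R(x₁ − 1) ≥ r₊ + θ(r₊−r₋)`,
`R(x₂ + 1) ≤ Θ`. For `|a| ≤ a₀ < M` this is DRSR Thm 8.1 (ranges `𝓖^♯`, `𝓖_♮`, `𝓖_♭` ∩ cone) with `κ` bounded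
below; the content is `a₀ → M`.
HOW (the card's lever, sharpened by triage r1-1): on the resolved space the cone is covered by (1) the FRONT FACE
`κ = 0`, `(x, ξ̃ = ξ/m, h = 1/|m|)` — the near-NHEK₁ ODE of S1, explicit hypergeometric connection data
(`Γ`-functions; exponents `x^{∓iξ}`, `x^{−1/2±ν}`, `ν² = λ + 1/4 − 7m²/4 + …`), red-shift/`Q^K`-current at the
unit-temperature horizon, DRSR-type virial current across the in-throat trapping `x₀(ξ̃, ν̃) ≥ 0.077`
(non-degenerate: triage T2 and the ideator's Lyapunov desk check `λ_t/κ → 1.000`), all uniform in `h` by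
semiclassical ODE analysis in `h`; (2) the FAR FACE = extremal Kerr `a = M` at the threshold frequency
`ω = m/(2M)` on `r − M ≳ 1` (`Kerr.IsRadialTeukolskySolution M M 0 (m/(2M)) m λ`; TdC Prop. 6.2 exponents
`(r−M)^{−1/2 ± √(1/4 + λ − 7m²/4)}`; throat sectors `Λ < 2m²` barrier-free at threshold, stable sectors with an
evanescent layer — the `a = M` identity of the sibling card `bf-sign-frozen-ranges`, triage (C1)–(C2)); (3) MATCHING
on `1 ≪ x ≪ κ^{-1}` where both faces are the same power laws, with the phases `(r₊ − r₋)^{±iδ}` (throat) /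
suppression `(r₊−r₋)^{2ν}` (stable) — the only place `κ` enters, polynomially. Powers of `κ` in the conclusion are
kinematic: `dr* = (r²+a²)dr/Δ = dx/(2κ̂ x(x+1))·(1 + O(κx))` stretches the window by `κ^{-1}|log|`, and
`∂_{t*} = κ∂_{t̂} + ω₊∂_{φ̂}`.
WHY IT MIGHT FAIL (honest residual, = the card's and triage's): the double corner `ν → 0` (sectors
`Λ/m² ↓ μ_c² ≈ 0.74²·…`, where front-face trapping `x₀ → ∞` meets the far-face trapping of extremal Kerr) and
`ξ̃ → ∞`; a super-polynomial loss there for a sequence `κ_n → 0` refutes the stub (and, by the kill criterion of the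
route, the crux as typed). Cheapest falsifier: Leaver/continued-fraction scan of `inf_ω |𝔚|·κ^{N}` over
`(ℓ, m) ≤ 30` at `a/M = 1 − 10^{−k}` (card (b); kit job j006768 of the ideator).
Leans on: S1; `KerrSeparatedPotential` (`sepPotential`, `omega_sq_sub_sepPotential_rPlus`,
`le_deriv_sepPotential₀_rPlus` — the `∝ (r₊ − M)` slope that the blow-up renormalises), `KerrSeparatedTrapping`
(`sepPotential₀_trichotomy`, `exists_sepPotential₀_rmax_sub_sq_ge'`), `KerrFrequencyRanges`,
`KerrSeparatedCurrents`/`KerrCombinedCurrent` (`combined_estimate_of_boundary_sign`,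
`horizonFlux_le_mul_integral_cutoff`), `KerrTrappingEstimate.trapping_estimate_of_isFreqNatural'` (template:
Prop. 8.6.1 PROVED in tree at fixed `a`), `KerrTortoiseRadius`, `KerrSurfaceGravity`
(`mul_surfaceGravity_mem_Icc`), `Kerr.horizonExponent`; literature DRSR §8 (Props 8.3.1–8.7.3), TdC 2020 §6
(Prop. 6.2/6.3, Lemma 6.x ODE comparison uniform in `a ≤ M`), Yang–Zimmerman–Zenginoğlu–Zhang–Berti–Chen
arXiv:1212.3271 (matched expansions), Gralla–Zimmerman–Zimmerman arXiv:1608.04739, Dyatlov arXiv:1305.1723,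
Olver (uniform asymptotics through turning points). Size XL; natural internal cut for the lead: (a) front-face
`h`-uniform current estimate for the model ODE, (b) far-face threshold estimate on `r − M ≥ c`, (c) gluing +
perturbation `O(κx)` on `x ≤ κ^{-1/2}`, (d) bounded `|m| ≤ m₀` sub-case (where TdC-type continuity suffices). -/
theorem stub_coneEstimate :
    (∀ (M a m lam ξ : ℝ), 0 < M → |a| < M → ∀ R : ℝ → ℂ,
        (Kerr.IsRadialTeukolskySolution M a 0 (m * Kerr.horizonAngularVelocity M a + 2 * Kerr.surfaceGravity M a * ξ) m lam R ↔
          ∃ S' S'' : ℝ → ℂ, ∀ x : ℝ, 0 < x →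
            HasDerivAt (fun y : ℝ ↦ R (Kerr.rPlus M a + (Kerr.rPlus M a - Kerr.rMinus M a) * y))
                (S' x) x ∧
              HasDerivAt S' (S'' x) x ∧
              ((x * (x + 1) : ℝ) : ℂ) * S'' x + ((2 * x + 1 : ℝ) : ℂ) * S' x +
                  (((ξ + (m * Kerr.horizonAngularVelocity M a + 2 * Kerr.surfaceGravity M a * ξ) * x * (2 * Kerr.rPlus M a + (Kerr.rPlus M a - Kerr.rMinus M a) * x)) ^ 2 /
                          (x * (x + 1)) -
                        lam - a ^ 2 * (m * Kerr.horizonAngularVelocity M a + 2 * Kerr.surfaceGravity M a * ξ) ^ 2 + 2 * a * m * (m * Kerr.horizonAngularVelocity M a + 2 * Kerr.surfaceGravity M a * ξ) : ℝ) : ℂ) *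
                    R (Kerr.rPlus M a + (Kerr.rPlus M a - Kerr.rMinus M a) * x) = 0)) ∧
      (∀ (M m ξ x : ℝ), 0 < M →
        Tendsto (fun b : ℝ ↦ (m * Kerr.horizonAngularVelocity M b + 2 * Kerr.surfaceGravity M b * ξ) * x * (2 * Kerr.rPlus M b + (Kerr.rPlus M b - Kerr.rMinus M b) * x))
          (𝓝[<] M) (𝓝 (m * x))) ∧
      (∀ (M m lam ξ : ℝ), 0 < M →
        Tendsto (fun b : ℝ ↦ -lam - b ^ 2 * (m * Kerr.horizonAngularVelocity M b + 2 * Kerr.surfaceGravity M b * ξ) ^ 2 + 2 * b * m * (m * Kerr.horizonAngularVelocity M b + 2 * Kerr.surfaceGravity M b * ξ)) (𝓝[<] M)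
          (𝓝 (-lam + 3 * m ^ 2 / 4))) →
    (∀ M : ℝ, 0 < M → ∀ θ : ℝ, 0 < θ → ∀ Θ : ℝ, 0 < Θ →
      ∃ (N : ℕ) (ε₀ b B ωl ωh Λh : ℝ), 0 < ε₀ ∧ 0 < b ∧ 0 < B ∧ 0 < ωl ∧
        ∀ a : ℝ, Kerr.IsSubextremal M a → ∀ R : ℝ → ℝ, Kerr.IsTortoiseRadius M a R →
          ∀ (ω : ℝ) (m : ℤ) (Λ : ℝ), Kerr.IsAdmissibleTriple a ω m Λ → m ≠ 0 → |ω - Kerr.horizonAngularVelocity M a * m| ≤ ε₀ * |(m : ℝ)| →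
            ∃ (μ : Kerr.Multipliers) (E rtrap fH yH χ₁H χ₂H fI yI X : ℝ),
              μ.HasDerivs ∧ μ.EndLimits atBot fH yH χ₁H χ₂H ∧ μ.EndLimits atTop fI yI 0 1 ∧
              0 ≤ E ∧ E ≤ B * (Kerr.surfaceGravity M a)⁻¹ ^ N ∧
              (∀ x, |μ.f x| + |μ.h x| + |μ.y x| + |μ.χ₁ x| + |μ.χ₂ x| +
                  (R x ^ 2 + a ^ 2) / Kerr.delta M a (R x) * |μ.f' x| ≤ B * (Kerr.surfaceGravity M a)⁻¹ ^ N) ∧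
              (rtrap = 0 ∨ (Kerr.rPlus M a + b * Kerr.surfaceGravity M a ^ N ≤ rtrap ∧ rtrap ≤ B)) ∧
              R X ≤ B ∧
              (∀ x, X ≤ x →
                |μ.f x + μ.y x - 1| ≤ B * Real.exp (-(b * Kerr.surfaceGravity M a ^ N) * (x - X)) ∧
                  μ.f' x = 0 ∧ μ.h x = 0 ∧ μ.χ₁ x = 0 ∧ μ.χ₂ x = 1) ∧
              ∀ (u u₁ u₂ H : ℝ → ℂ) (Atop Abot x₁ x₂ : ℝ), x₁ ≤ x₂ →
                Kerr.rPlus M a + θ * (Kerr.rPlus M a - Kerr.rMinus M a) ≤ R (x₁ - 1) →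
                R (x₂ + 1) ≤ Θ →
                (∀ x, HasDerivAt u (u₁ x) x) → (∀ x, HasDerivAt u₁ (u₂ x) x) →
                (∀ x, u₂ x + ((ω ^ 2 - Kerr.sepPotential M a ω m Λ (R x) : ℝ) : ℂ) * u x = H x) →
                Continuous H →
                Integrable (Kerr.combinedSource ω (ω - Kerr.horizonAngularVelocity M a * m) E μ u u₁ H) →
                Kerr.OutgoingBoundary ω (ω - Kerr.horizonAngularVelocity M a * m) (fun x ↦ Kerr.sepPotential M a ω m Λ (R x)) u u₁
                  Atop Abot →
                b * Kerr.surfaceGravity M a ^ N *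
                    ∫ x in x₁..x₂,
                      (‖u₁ x‖ ^ 2 + ((1 - rtrap / R x) ^ 2 * (ω ^ 2 + Λ) + 1) * ‖u x‖ ^ 2) ≤
                  (∫ x, Kerr.combinedSource ω (ω - Kerr.horizonAngularVelocity M a * m) E μ u u₁ H x) +
                    (if ωl ≤ |ω| ∧ |ω| ≤ ωh ∧ Λ ≤ Λh then B * (Kerr.surfaceGravity M a)⁻¹ ^ N * Abot else 0)) := by
  sorry

/-- **S3 · `stub_offConeEstimate` — DRSR Theorem 8.1 OFF the threshold cone with tracked constants.** Same
conclusion shape as S2, for the admissible triples with `m = 0` or `|ω − mω₊| ≥ ε₀|m|`, for EVERY aperture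
`ε₀ > 0` (constants may depend on `ε₀`, `θ`, `Θ`, `M`; the transfer feeds in the `ε₀` produced by S2).
Why plausibly true: off the cone none of DRSR's three degenerations occurs — the horizon boundary term carries
`ω² − V(r₊) = (ω − ω₊m)² ≥ ε₀²m²` (`Kerr.omega_sq_sub_sepPotential_rPlus`; for `m = 0` the superradiant set is
empty), "superradiant ⇒ not trapped" holds with an `ε₀`-margin that survives `a = M` (mid-band check in the plan
notes: at `a = M`, `ω = mω₊/2`, `Λ = m²`: `V₀,max − ω² ≈ (0.08 − 0.0625)m²/M² > 0`; it closes only AT threshold), and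
trapping for off-cone frequencies stays at `r − r₊ ≳ c(ε₀)M` where the potential converges in `C²` as `a → M`;
what DOES change is the horizon end of the `r*`-line (`Δ` acquires a double root: `r*`-lengths of `r`-windows near
`r₊` grow like `κ^{-1}log`), which costs powers of `κ` in `b` (window `x ≥ θ` in blown-up depth) — hence `κ^{±N}`,
not uniform constants. The proof is DRSR §8 (Props 8.3.1 `𝓖^♯` with the REPAIRED strip of `KerrFrequencyRanges`,
8.4.1 `𝓖_♯`, 8.5.1 `𝓖_𝄬`, 8.6.1 `𝓖_♮` — PROVED in tree as `trapping_estimate_of_isFreqNatural'` at fixed `a` —,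
8.7.1–8.7.3 `𝓖_♭`) re-run with every "sufficiently large/small depending on `a₀`" made an explicit power of `κ`
and of `ε₀`. Why it might fail: a hidden `exp(C/κ)` in the choice of the large parameters (`ω_high`, `E`,
`R_∞*`) of §8.3–8.6 as `a₀ → M` even off the cone (none is visible: the `a₀`-dependence enters through `b(a₀)` of
Lemma 6.4.1/6.4.2, which is cone business, and through `r*`-lengths). Leans on: the whole DRSR block of
`Literature/Geometry/Lorentzian/Kerr{SeparatedPotential,SeparatedTrapping,FrequencyRanges,SeparatedCurrents,
TimeDominatedCurrent,TimeDominatedEstimate,CombinedCurrent,TrappingMultipliers,TrappingRangeStructure,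
TrappingEstimate,LargeSuperradiantPotential,LowFrequency*,FlatRangeWeight,TortoiseRadius}.lean`. Size L–XL
(mostly bookkeeping over proved tree material; the `𝓖_♭` currents of §8.7 are not yet in tree). -/
theorem stub_offConeEstimate :
    (∀ M : ℝ, 0 < M → ∀ θ : ℝ, 0 < θ → ∀ Θ : ℝ, 0 < Θ → ∀ ε₀ : ℝ, 0 < ε₀ →
      ∃ (N : ℕ) (b B ωl ωh Λh : ℝ), 0 < b ∧ 0 < B ∧ 0 < ωl ∧
        ∀ a : ℝ, Kerr.IsSubextremal M a → ∀ R : ℝ → ℝ, Kerr.IsTortoiseRadius M a R →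
          ∀ (ω : ℝ) (m : ℤ) (Λ : ℝ), Kerr.IsAdmissibleTriple a ω m Λ → (m = 0 ∨ ε₀ * |(m : ℝ)| ≤ |ω - Kerr.horizonAngularVelocity M a * m|) →
            ∃ (μ : Kerr.Multipliers) (E rtrap fH yH χ₁H χ₂H fI yI X : ℝ),
              μ.HasDerivs ∧ μ.EndLimits atBot fH yH χ₁H χ₂H ∧ μ.EndLimits atTop fI yI 0 1 ∧
              0 ≤ E ∧ E ≤ B * (Kerr.surfaceGravity M a)⁻¹ ^ N ∧
              (∀ x, |μ.f x| + |μ.h x| + |μ.y x| + |μ.χ₁ x| + |μ.χ₂ x| +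
                  (R x ^ 2 + a ^ 2) / Kerr.delta M a (R x) * |μ.f' x| ≤ B * (Kerr.surfaceGravity M a)⁻¹ ^ N) ∧
              (rtrap = 0 ∨ (Kerr.rPlus M a + b * Kerr.surfaceGravity M a ^ N ≤ rtrap ∧ rtrap ≤ B)) ∧
              R X ≤ B ∧
              (∀ x, X ≤ x →
                |μ.f x + μ.y x - 1| ≤ B * Real.exp (-(b * Kerr.surfaceGravity M a ^ N) * (x - X)) ∧
                  μ.f' x = 0 ∧ μ.h x = 0 ∧ μ.χ₁ x = 0 ∧ μ.χ₂ x = 1) ∧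
              ∀ (u u₁ u₂ H : ℝ → ℂ) (Atop Abot x₁ x₂ : ℝ), x₁ ≤ x₂ →
                Kerr.rPlus M a + θ * (Kerr.rPlus M a - Kerr.rMinus M a) ≤ R (x₁ - 1) →
                R (x₂ + 1) ≤ Θ →
                (∀ x, HasDerivAt u (u₁ x) x) → (∀ x, HasDerivAt u₁ (u₂ x) x) →
                (∀ x, u₂ x + ((ω ^ 2 - Kerr.sepPotential M a ω m Λ (R x) : ℝ) : ℂ) * u x = H x) →
                Continuous H →
                Integrable (Kerr.combinedSource ω (ω - Kerr.horizonAngularVelocity M a * m) E μ u u₁ H) →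
                Kerr.OutgoingBoundary ω (ω - Kerr.horizonAngularVelocity M a * m) (fun x ↦ Kerr.sepPotential M a ω m Λ (R x)) u u₁
                  Atop Abot →
                b * Kerr.surfaceGravity M a ^ N *
                    ∫ x in x₁..x₂,
                      (‖u₁ x‖ ^ 2 + ((1 - rtrap / R x) ^ 2 * (ω ^ 2 + Λ) + 1) * ‖u x‖ ^ 2) ≤
                  (∫ x, Kerr.combinedSource ω (ω - Kerr.horizonAngularVelocity M a * m) E μ u u₁ H x) +
                    (if ωl ≤ |ω| ∧ |ω| ≤ ωh ∧ Λ ≤ Λh then B * (Kerr.surfaceGravity M a)⁻¹ ^ N * Abot else 0)) := by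
  sorry

/-- **S4 · `stub_boxWronskian` — quantitative real-axis mode stability on bounded frequency boxes, UNIFORM in
`|a| < M` (Teixeira da Costa 2020, Prop. 6.3 ⊇ Thm 5.1, scalar case `s = 0`).** For `M > 0` there is
`G = G(·; M)` with `|𝔚|^{-2} ≤ G(C)` for all `|a| < M`, integer `m`, real `ω ≠ 0`, real `λ` with
`|ω| + |ω|⁻¹ + |m| + |λ| ≤ C` and all horizon- and infinity-normalised radial solutions (`𝔚 = Δ(R_𝓗R′_𝓘 − R_𝓘R′_𝓗)`,
`Kerr.radialWronskian`). This is LITERALLY the tree's named fact `Kerr.Costa2019_wronskianBound_subextremal`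
(file `TeukolskyWronskianBound.lean`, cite item wi-26994, vendored for this crux; UNPROVED in tree) at `s = 0`:
certificate `boxWronskian_of_fact` below — the stub closes the moment a `…_holds` proof of the fact lands, and
until then the line is honestly CONDITIONAL on TdC Prop. 6.3 (77 pp. of ODE analysis; published, CMP 378 (2020)).
Role: it retires the "quantitative mode stability inexplicit in `a`" clause of the crux's why-might-fail
(Shlapentokh-Rothman arXiv:1302.6902 Thm 1.4 has `G(C, a, M)`); the transfer (S5) turns it into the `κ`-uniform
bound for the box term `1_{box}·A_𝓗` of S2/S3 by Shlapentokh-Rothman's argument (his §4: representation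
`u(−∞) = 𝔚⁻¹∫u_out H`, Thm 1.7), run with `a`-uniform profile bounds on the box. Size: 0 as a citation / XL as a
formalisation. -/
theorem stub_boxWronskian :
    (∀ M : ℝ, 0 < M → ∃ G : ℝ → ℝ, ∀ (C a ω m lam : ℝ), |a| < M → (∃ k : ℤ, m = k) → ω ≠ 0 →
      |ω| + |ω|⁻¹ + |m| + |lam| ≤ C → ∀ RH RI : ℝ → ℂ,
        Kerr.IsRadialTeukolskySolution M a 0 ω m lam RH → Kerr.IsNormalisedHorizonSolution M a 0 ω m RH →
        Kerr.IsRadialTeukolskySolution M a 0 ω m lam RI → Kerr.IsNormalisedInfinitySolution M 0 ω RI →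
          0 < G C ∧ ∀ r : ℝ, Kerr.rPlus M a < r → 1 ≤ G C * ‖Kerr.radialWronskian M a 0 RH RI r‖ ^ 2) := by
  sorry

/-- **S5 · `stub_integratedDecay` — phase space ⇒ clause (b): `κ`-explicit integrated local energy decay
(DRSR §§9–12 with tracked constants).** From the cone estimate (conclusion of S2), the off-cone estimate (S3) and
the box Wronskian bound (S4): for every `M > 0` there are `p`, `j` such that for every coordinate radius `R` some
`C(M, R) < ∞` bounds `∫₀^∞ E_loc(τ, R) dτ ≤ C·(1 − (a/M)²)^{−p}·E_j[ψ](0)` for all `|a| < M` and all admissible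
waves (the crux's clause (b) VERBATIM, with its own `∃ p j`).
How: DRSR §9 for the Kerr–Schild foliation `{t*_KS = τ} ∩ {r > r₊}` of the crux — cut-off `ψ_✂ = ξ(τ)ψ`, Carter
separation of `□ψ_✂ = F` (oblate spheroidal harmonics; NOT yet in tree: `KerrSeparatedProfile` has only
separated profiles), S2 ∨ S3 at each admissible `(ω, m, Λ_{mℓ}(aω))` (cover: `m = 0 ∨ |ω − mω₊| < ε₀|m| ∨ ≥`),
summation + Plancherel, the cut-off error terms of §9.3–9.6 with the red-shift multiplier `N` of strength
`b_red ≍ κ` on the collar `x ≤ θ` (Dafermos–Rodnianski; tree `KerrRedShiftBulk`, `RedShiftedCollar`) and the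
large-`r` current (`KerrLargeRCurrent`, `KerrFarMorawetzCoercivity`), the box horizon term via S4 +
Shlapentokh-Rothman's §4 (hyperboloidal comparison slice as in DRSR Prop. 9.7.1), the higher-order statement §10
(commutation with `T`, `N`, elliptic estimates), the reduction `a ↦ −a` (§4.2); every constant a monomial in
`κ^{-1}`, `θ^{-1}`, the S2–S4 constants, hence in `χ^{-1}` (`Kerr.mul_surfaceGravity_mem_Icc`). A-priori
future-integrability of `ψ` (needed to separate): DRSR §11's continuity argument re-run QUALITATIVELY with S2/S3 as
the closed-range input (or, conditionally, the per-`a` named facts `drsr_wave_*`). Coordinate energies ≍ `J^N`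
fluxes on Kerr–Schild leaves uniformly in `a` (refuter rattack-10654: `0 ≤ H ≤ M/r₊ ≤ 1`). Why it might fail:
only through its inputs — given S2–S4 the architecture is DRSR's; the one `κ`-sensitive physical-space constant is
the red-shift `b_red ∝ κ`, a power. Leans on: `KerrWaveEnergy`/`KerrIntegratedDecay`/`KerrLocalEnergyDecay`
(vocabulary `sliceEnergy`, `localSliceEnergy`, `sliceSobolevEnergy`, `IsAdmissibleKerrWave` = the inlined
clause, `Iff.rfl`), `KerrRedShiftBulk`, `KerrSchild*Energy*`, `KerrFiniteSpeedOfPropagation`,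
`KerrHyperboloidal*`, `kerr_far_TEnergy_comparison`; DRSR §§4, 9–12; SR 2015 §4. Size XL. -/
theorem stub_integratedDecay :
    (∀ M : ℝ, 0 < M → ∀ θ : ℝ, 0 < θ → ∀ Θ : ℝ, 0 < Θ →
      ∃ (N : ℕ) (ε₀ b B ωl ωh Λh : ℝ), 0 < ε₀ ∧ 0 < b ∧ 0 < B ∧ 0 < ωl ∧
        ∀ a : ℝ, Kerr.IsSubextremal M a → ∀ R : ℝ → ℝ, Kerr.IsTortoiseRadius M a R →
          ∀ (ω : ℝ) (m : ℤ) (Λ : ℝ), Kerr.IsAdmissibleTriple a ω m Λ → m ≠ 0 → |ω - Kerr.horizonAngularVelocity M a * m| ≤ ε₀ * |(m : ℝ)| →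
            ∃ (μ : Kerr.Multipliers) (E rtrap fH yH χ₁H χ₂H fI yI X : ℝ),
              μ.HasDerivs ∧ μ.EndLimits atBot fH yH χ₁H χ₂H ∧ μ.EndLimits atTop fI yI 0 1 ∧
              0 ≤ E ∧ E ≤ B * (Kerr.surfaceGravity M a)⁻¹ ^ N ∧
              (∀ x, |μ.f x| + |μ.h x| + |μ.y x| + |μ.χ₁ x| + |μ.χ₂ x| +
                  (R x ^ 2 + a ^ 2) / Kerr.delta M a (R x) * |μ.f' x| ≤ B * (Kerr.surfaceGravity M a)⁻¹ ^ N) ∧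
              (rtrap = 0 ∨ (Kerr.rPlus M a + b * Kerr.surfaceGravity M a ^ N ≤ rtrap ∧ rtrap ≤ B)) ∧
              R X ≤ B ∧
              (∀ x, X ≤ x →
                |μ.f x + μ.y x - 1| ≤ B * Real.exp (-(b * Kerr.surfaceGravity M a ^ N) * (x - X)) ∧
                  μ.f' x = 0 ∧ μ.h x = 0 ∧ μ.χ₁ x = 0 ∧ μ.χ₂ x = 1) ∧
              ∀ (u u₁ u₂ H : ℝ → ℂ) (Atop Abot x₁ x₂ : ℝ), x₁ ≤ x₂ →
                Kerr.rPlus M a + θ * (Kerr.rPlus M a - Kerr.rMinus M a) ≤ R (x₁ - 1) →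
                R (x₂ + 1) ≤ Θ →
                (∀ x, HasDerivAt u (u₁ x) x) → (∀ x, HasDerivAt u₁ (u₂ x) x) →
                (∀ x, u₂ x + ((ω ^ 2 - Kerr.sepPotential M a ω m Λ (R x) : ℝ) : ℂ) * u x = H x) →
                Continuous H →
                Integrable (Kerr.combinedSource ω (ω - Kerr.horizonAngularVelocity M a * m) E μ u u₁ H) →
                Kerr.OutgoingBoundary ω (ω - Kerr.horizonAngularVelocity M a * m) (fun x ↦ Kerr.sepPotential M a ω m Λ (R x)) u u₁
                  Atop Abot →
                b * Kerr.surfaceGravity M a ^ N *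
                    ∫ x in x₁..x₂,
                      (‖u₁ x‖ ^ 2 + ((1 - rtrap / R x) ^ 2 * (ω ^ 2 + Λ) + 1) * ‖u x‖ ^ 2) ≤
                  (∫ x, Kerr.combinedSource ω (ω - Kerr.horizonAngularVelocity M a * m) E μ u u₁ H x) +
                    (if ωl ≤ |ω| ∧ |ω| ≤ ωh ∧ Λ ≤ Λh then B * (Kerr.surfaceGravity M a)⁻¹ ^ N * Abot else 0)) →
    (∀ M : ℝ, 0 < M → ∀ θ : ℝ, 0 < θ → ∀ Θ : ℝ, 0 < Θ → ∀ ε₀ : ℝ, 0 < ε₀ →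
      ∃ (N : ℕ) (b B ωl ωh Λh : ℝ), 0 < b ∧ 0 < B ∧ 0 < ωl ∧
        ∀ a : ℝ, Kerr.IsSubextremal M a → ∀ R : ℝ → ℝ, Kerr.IsTortoiseRadius M a R →
          ∀ (ω : ℝ) (m : ℤ) (Λ : ℝ), Kerr.IsAdmissibleTriple a ω m Λ → (m = 0 ∨ ε₀ * |(m : ℝ)| ≤ |ω - Kerr.horizonAngularVelocity M a * m|) →
            ∃ (μ : Kerr.Multipliers) (E rtrap fH yH χ₁H χ₂H fI yI X : ℝ),
              μ.HasDerivs ∧ μ.EndLimits atBot fH yH χ₁H χ₂H ∧ μ.EndLimits atTop fI yI 0 1 ∧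
              0 ≤ E ∧ E ≤ B * (Kerr.surfaceGravity M a)⁻¹ ^ N ∧
              (∀ x, |μ.f x| + |μ.h x| + |μ.y x| + |μ.χ₁ x| + |μ.χ₂ x| +
                  (R x ^ 2 + a ^ 2) / Kerr.delta M a (R x) * |μ.f' x| ≤ B * (Kerr.surfaceGravity M a)⁻¹ ^ N) ∧
              (rtrap = 0 ∨ (Kerr.rPlus M a + b * Kerr.surfaceGravity M a ^ N ≤ rtrap ∧ rtrap ≤ B)) ∧
              R X ≤ B ∧
              (∀ x, X ≤ x →
                |μ.f x + μ.y x - 1| ≤ B * Real.exp (-(b * Kerr.surfaceGravity M a ^ N) * (x - X)) ∧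
                  μ.f' x = 0 ∧ μ.h x = 0 ∧ μ.χ₁ x = 0 ∧ μ.χ₂ x = 1) ∧
              ∀ (u u₁ u₂ H : ℝ → ℂ) (Atop Abot x₁ x₂ : ℝ), x₁ ≤ x₂ →
                Kerr.rPlus M a + θ * (Kerr.rPlus M a - Kerr.rMinus M a) ≤ R (x₁ - 1) →
                R (x₂ + 1) ≤ Θ →
                (∀ x, HasDerivAt u (u₁ x) x) → (∀ x, HasDerivAt u₁ (u₂ x) x) →
                (∀ x, u₂ x + ((ω ^ 2 - Kerr.sepPotential M a ω m Λ (R x) : ℝ) : ℂ) * u x = H x) →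
                Continuous H →
                Integrable (Kerr.combinedSource ω (ω - Kerr.horizonAngularVelocity M a * m) E μ u u₁ H) →
                Kerr.OutgoingBoundary ω (ω - Kerr.horizonAngularVelocity M a * m) (fun x ↦ Kerr.sepPotential M a ω m Λ (R x)) u u₁
                  Atop Abot →
                b * Kerr.surfaceGravity M a ^ N *
                    ∫ x in x₁..x₂,
                      (‖u₁ x‖ ^ 2 + ((1 - rtrap / R x) ^ 2 * (ω ^ 2 + Λ) + 1) * ‖u x‖ ^ 2) ≤
                  (∫ x, Kerr.combinedSource ω (ω - Kerr.horizonAngularVelocity M a * m) E μ u u₁ H x) +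
                    (if ωl ≤ |ω| ∧ |ω| ≤ ωh ∧ Λ ≤ Λh then B * (Kerr.surfaceGravity M a)⁻¹ ^ N * Abot else 0)) →
    (∀ M : ℝ, 0 < M → ∃ G : ℝ → ℝ, ∀ (C a ω m lam : ℝ), |a| < M → (∃ k : ℤ, m = k) → ω ≠ 0 →
      |ω| + |ω|⁻¹ + |m| + |lam| ≤ C → ∀ RH RI : ℝ → ℂ,
        Kerr.IsRadialTeukolskySolution M a 0 ω m lam RH → Kerr.IsNormalisedHorizonSolution M a 0 ω m RH →
        Kerr.IsRadialTeukolskySolution M a 0 ω m lam RI → Kerr.IsNormalisedInfinitySolution M 0 ω RI →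
          0 < G C ∧ ∀ r : ℝ, Kerr.rPlus M a < r → 1 ≤ G C * ‖Kerr.radialWronskian M a 0 RH RI r‖ ^ 2) →
    (∀ [Kerr.Facts] [Kerr.SliceFacts], ∀ M : ℝ, 0 < M → ∃ (p : ℝ) (j : ℕ), ∀ R : ℝ, ∃ C : ENNReal, C < ⊤ ∧ ∀ a : ℝ, Kerr.IsSubextremal M a → ∀ ψ : Kerr.exterior M a → ℝ, (ContMDiff 𝓘(ℝ, E4) 𝓘(ℝ, ℝ) ((⊤ : ℕ∞) : WithTop ℕ∞) ψ ∧ (∀ x, (Kerr.smoothMetric M a (Kerr.rPlus M a)).toPseudoRiemannianMetric.dalembertian ψ x = 0) ∧ ∃ K : Set (Kerr.exterior M a), IsCompact K ∧ ∀ x : Kerr.exterior M a, (x : E4) 0 = 0 → x ∉ K → ψ x = 0 ∧ mfderiv 𝓘(ℝ, E4) 𝓘(ℝ, ℝ) ψ x = 0) → ∫⁻ τ in Ioi (0 : ℝ), localSliceEnergy (Kerr.exterior M a) ψ τ R ≤ C * ENNReal.ofReal ((1 - (a / M) ^ 2) ^ (-p)) * ∫⁻ y : E3, {y | E4.ofTimeSpace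 0 y ∈ Kerr.exterior M a}.indicator (fun y ↦ ENNReal.ofReal (∑ m ∈ Finset.range (j + 1), ‖iteratedFDeriv ℝ m (Function.extend Subtype.val ψ (0 : E4 → ℝ)) (E4.ofTimeSpace 0 y)‖ ^ 2)) y) := by
  sorry

/-- **S6 · `stub_boundedness` — phase space + (b) ⇒ clause (a): `κ`-explicit uniform energy boundedness (DRSR
§13 with tracked constants).** From S2's conclusion, S3, S4 and clause (b) (conclusion of S5): for every `M > 0`
there are `p`, `j`, `C(M) < ∞` with `sliceEnergy(ψ, τ) ≤ C·(1 − (a/M)²)^{−p}·E_j[ψ](0)` for all `τ ≥ 0`, all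
`|a| < M`, all admissible `ψ` (the crux's clause (a) VERBATIM, with its own `∃ p j`).
How: DRSR §13 ("boundedness", proof of Thm 3.1): split `ψ_✂` in phase space into its superradiant part `ψ_♭`
(`0 < mω < m²ω₊ + …`) and the rest `ψ_♯`; for `ψ_♯` the `J^T`-flux through `𝓗⁺` has a sign, for `ψ_♭` the
microlocal ILED of S2/S3 (LHS with the non-degenerate `+1·|u|²`, superradiant frequencies not trapped) plus the
horizon/null-infinity fluxes bound the energy radiated through `𝓗⁺`; red-shift (`∝ κ`) and the large-`r`
current convert `J^T`/`J^K` control into the non-degenerate `sliceEnergy` of the Kerr–Schild leaves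
(`KerrSchildEnergyEstimate`, `KerrLeafEnergyComparison`); the inhomogeneous terms from the phase-space cut-offs
are the ones already estimated in S5. Why it might fail: near-extremal superradiant AMPLIFICATION is bounded
(Starobinsky–Teukolsky–Press; `≤ 4.4%` per scalar mode near `m = ℓ`, `a → M`) — a `κ`-uniform bound on the
amplification factor is implicit in S2 (cone, `ξ̃ < 0` side); if the energy extracted by a wave packet parked at
the threshold could grow like `exp(c/κ)` this stub (and the crux) would be false, but the superradiant flux is
`∝ ωϖ|u(−∞)|²` with `|ϖ| ≤ ε₀|m|` in the cone, i.e. small, and S2's `A_𝓗`-control is polynomial. Leans on: as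
S5, plus `KerrSchildKillingEnergy`, `KerrHawkingField` (`J^K`, `K = T + ω₊Φ` null on `𝓗⁺`), `KerrFluxComparison`,
`KerrLeafCoercivity`; DRSR §13, Dafermos–Rodnianski arXiv:1010.5132 §§4–5. Size L–XL. -/
theorem stub_boundedness :
    (∀ M : ℝ, 0 < M → ∀ θ : ℝ, 0 < θ → ∀ Θ : ℝ, 0 < Θ →
      ∃ (N : ℕ) (ε₀ b B ωl ωh Λh : ℝ), 0 < ε₀ ∧ 0 < b ∧ 0 < B ∧ 0 < ωl ∧
        ∀ a : ℝ, Kerr.IsSubextremal M a → ∀ R : ℝ → ℝ, Kerr.IsTortoiseRadius M a R →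
          ∀ (ω : ℝ) (m : ℤ) (Λ : ℝ), Kerr.IsAdmissibleTriple a ω m Λ → m ≠ 0 → |ω - Kerr.horizonAngularVelocity M a * m| ≤ ε₀ * |(m : ℝ)| →
            ∃ (μ : Kerr.Multipliers) (E rtrap fH yH χ₁H χ₂H fI yI X : ℝ),
              μ.HasDerivs ∧ μ.EndLimits atBot fH yH χ₁H χ₂H ∧ μ.EndLimits atTop fI yI 0 1 ∧
              0 ≤ E ∧ E ≤ B * (Kerr.surfaceGravity M a)⁻¹ ^ N ∧
              (∀ x, |μ.f x| + |μ.h x| + |μ.y x| + |μ.χ₁ x| + |μ.χ₂ x| +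
                  (R x ^ 2 + a ^ 2) / Kerr.delta M a (R x) * |μ.f' x| ≤ B * (Kerr.surfaceGravity M a)⁻¹ ^ N) ∧
              (rtrap = 0 ∨ (Kerr.rPlus M a + b * Kerr.surfaceGravity M a ^ N ≤ rtrap ∧ rtrap ≤ B)) ∧
              R X ≤ B ∧
              (∀ x, X ≤ x →
                |μ.f x + μ.y x - 1| ≤ B * Real.exp (-(b * Kerr.surfaceGravity M a ^ N) * (x - X)) ∧
                  μ.f' x = 0 ∧ μ.h x = 0 ∧ μ.χ₁ x = 0 ∧ μ.χ₂ x = 1) ∧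
              ∀ (u u₁ u₂ H : ℝ → ℂ) (Atop Abot x₁ x₂ : ℝ), x₁ ≤ x₂ →
                Kerr.rPlus M a + θ * (Kerr.rPlus M a - Kerr.rMinus M a) ≤ R (x₁ - 1) →
                R (x₂ + 1) ≤ Θ →
                (∀ x, HasDerivAt u (u₁ x) x) → (∀ x, HasDerivAt u₁ (u₂ x) x) →
                (∀ x, u₂ x + ((ω ^ 2 - Kerr.sepPotential M a ω m Λ (R x) : ℝ) : ℂ) * u x = H x) →
                Continuous H →
                Integrable (Kerr.combinedSource ω (ω - Kerr.horizonAngularVelocity M a * m) E μ u u₁ H) →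
                Kerr.OutgoingBoundary ω (ω - Kerr.horizonAngularVelocity M a * m) (fun x ↦ Kerr.sepPotential M a ω m Λ (R x)) u u₁
                  Atop Abot →
                b * Kerr.surfaceGravity M a ^ N *
                    ∫ x in x₁..x₂,
                      (‖u₁ x‖ ^ 2 + ((1 - rtrap / R x) ^ 2 * (ω ^ 2 + Λ) + 1) * ‖u x‖ ^ 2) ≤
                  (∫ x, Kerr.combinedSource ω (ω - Kerr.horizonAngularVelocity M a * m) E μ u u₁ H x) +
                    (if ωl ≤ |ω| ∧ |ω| ≤ ωh ∧ Λ ≤ Λh then B * (Kerr.surfaceGravity M a)⁻¹ ^ N * Abot else 0)) →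
    (∀ M : ℝ, 0 < M → ∀ θ : ℝ, 0 < θ → ∀ Θ : ℝ, 0 < Θ → ∀ ε₀ : ℝ, 0 < ε₀ →
      ∃ (N : ℕ) (b B ωl ωh Λh : ℝ), 0 < b ∧ 0 < B ∧ 0 < ωl ∧
        ∀ a : ℝ, Kerr.IsSubextremal M a → ∀ R : ℝ → ℝ, Kerr.IsTortoiseRadius M a R →
          ∀ (ω : ℝ) (m : ℤ) (Λ : ℝ), Kerr.IsAdmissibleTriple a ω m Λ → (m = 0 ∨ ε₀ * |(m : ℝ)| ≤ |ω - Kerr.horizonAngularVelocity M a * m|) →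
            ∃ (μ : Kerr.Multipliers) (E rtrap fH yH χ₁H χ₂H fI yI X : ℝ),
              μ.HasDerivs ∧ μ.EndLimits atBot fH yH χ₁H χ₂H ∧ μ.EndLimits atTop fI yI 0 1 ∧
              0 ≤ E ∧ E ≤ B * (Kerr.surfaceGravity M a)⁻¹ ^ N ∧
              (∀ x, |μ.f x| + |μ.h x| + |μ.y x| + |μ.χ₁ x| + |μ.χ₂ x| +
                  (R x ^ 2 + a ^ 2) / Kerr.delta M a (R x) * |μ.f' x| ≤ B * (Kerr.surfaceGravity M a)⁻¹ ^ N) ∧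
              (rtrap = 0 ∨ (Kerr.rPlus M a + b * Kerr.surfaceGravity M a ^ N ≤ rtrap ∧ rtrap ≤ B)) ∧
              R X ≤ B ∧
              (∀ x, X ≤ x →
                |μ.f x + μ.y x - 1| ≤ B * Real.exp (-(b * Kerr.surfaceGravity M a ^ N) * (x - X)) ∧
                  μ.f' x = 0 ∧ μ.h x = 0 ∧ μ.χ₁ x = 0 ∧ μ.χ₂ x = 1) ∧
              ∀ (u u₁ u₂ H : ℝ → ℂ) (Atop Abot x₁ x₂ : ℝ), x₁ ≤ x₂ →
                Kerr.rPlus M a + θ * (Kerr.rPlus M a - Kerr.rMinus M a) ≤ R (x₁ - 1) →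
                R (x₂ + 1) ≤ Θ →
                (∀ x, HasDerivAt u (u₁ x) x) → (∀ x, HasDerivAt u₁ (u₂ x) x) →
                (∀ x, u₂ x + ((ω ^ 2 - Kerr.sepPotential M a ω m Λ (R x) : ℝ) : ℂ) * u x = H x) →
                Continuous H →
                Integrable (Kerr.combinedSource ω (ω - Kerr.horizonAngularVelocity M a * m) E μ u u₁ H) →
                Kerr.OutgoingBoundary ω (ω - Kerr.horizonAngularVelocity M a * m) (fun x ↦ Kerr.sepPotential M a ω m Λ (R x)) u u₁
                  Atop Abot →
                b * Kerr.surfaceGravity M a ^ N *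
                    ∫ x in x₁..x₂,
                      (‖u₁ x‖ ^ 2 + ((1 - rtrap / R x) ^ 2 * (ω ^ 2 + Λ) + 1) * ‖u x‖ ^ 2) ≤
                  (∫ x, Kerr.combinedSource ω (ω - Kerr.horizonAngularVelocity M a * m) E μ u u₁ H x) +
                    (if ωl ≤ |ω| ∧ |ω| ≤ ωh ∧ Λ ≤ Λh then B * (Kerr.surfaceGravity M a)⁻¹ ^ N * Abot else 0)) →
    (∀ M : ℝ, 0 < M → ∃ G : ℝ → ℝ, ∀ (C a ω m lam : ℝ), |a| < M → (∃ k : ℤ, m = k) → ω ≠ 0 →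
      |ω| + |ω|⁻¹ + |m| + |lam| ≤ C → ∀ RH RI : ℝ → ℂ,
        Kerr.IsRadialTeukolskySolution M a 0 ω m lam RH → Kerr.IsNormalisedHorizonSolution M a 0 ω m RH →
        Kerr.IsRadialTeukolskySolution M a 0 ω m lam RI → Kerr.IsNormalisedInfinitySolution M 0 ω RI →
          0 < G C ∧ ∀ r : ℝ, Kerr.rPlus M a < r → 1 ≤ G C * ‖Kerr.radialWronskian M a 0 RH RI r‖ ^ 2) →
    (∀ [Kerr.Facts] [Kerr.SliceFacts], ∀ M : ℝ, 0 < M → ∃ (p : ℝ) (j : ℕ), ∀ R : ℝ, ∃ C : ENNReal, C < ⊤ ∧ ∀ a : ℝ, Kerr.IsSubextremal M a → ∀ ψ : Kerr.exterior M a → ℝ, (ContMDiff 𝓘(ℝ, E4) 𝓘(ℝ, ℝ) ((⊤ : ℕ∞) : WithTop ℕ∞) ψ ∧ (∀ x, (Kerr.smoothMetric M a (Kerr.rPlus M a)).toPseudoRiemannianMetric.dalembertian ψ x = 0) ∧ ∃ K : Set (Kerr.exterior M a), IsCompact K ∧ ∀ x : Kerr.exterior M a, (x : E4) 0 = 0 →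 x ∉ K → ψ x = 0 ∧ mfderiv 𝓘(ℝ, E4) 𝓘(ℝ, ℝ) ψ x = 0) → ∫⁻ τ in Ioi (0 : ℝ), localSliceEnergy (Kerr.exterior M a) ψ τ R ≤ C * ENNReal.ofReal ((1 - (a / M) ^ 2) ^ (-p)) * ∫⁻ y : E3, {y | E4.ofTimeSpace 0 y ∈ Kerr.exterior M a}.indicator (fun y ↦ ENNReal.ofReal (∑ m ∈ Finset.range (j + 1), ‖iteratedFDeriv ℝ m (Function.extend Subtype.val ψ (0 : E4 → ℝ)) (E4.ofTimeSpace 0 y)‖ ^ 2)) y) →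
    (∀ [Kerr.Facts] [Kerr.SliceFacts], ∀ M : ℝ, 0 < M → ∃ (p : ℝ) (j : ℕ), ∃ C : ENNReal, C < ⊤ ∧ ∀ a : ℝ, Kerr.IsSubextremal M a → ∀ ψ : Kerr.exterior M a → ℝ, (ContMDiff 𝓘(ℝ, E4) 𝓘(ℝ, ℝ) ((⊤ : ℕ∞) : WithTop ℕ∞) ψ ∧ (∀ x, (Kerr.smoothMetric M a (Kerr.rPlus M a)).toPseudoRiemannianMetric.dalembertian ψ x = 0) ∧ ∃ K : Set (Kerr.exterior M a), IsCompact K ∧ ∀ x : Kerr.exterior M a, (x : E4) 0 = 0 → x ∉ K → ψ x = 0 ∧ mfderiv 𝓘(ℝ, E4) 𝓘(ℝ, ℝ) ψ x = 0) → ∀ τ : ℝ, 0 ≤ τ → sliceEnergy (Kerr.exterior M a) ψ τ ≤ C * ENNReal.ofReal ((1 - (a / M) ^ 2) ^ (-p)) * ∫⁻ y : E3, {y | E4.ofTimeSpace 0 y ∈ Kerr.exterior M a}.indicator (fun y ↦ ENNReal.ofReal (∑ m ∈ Finset.range (j + 1), ‖iteratedFDeriv ℝ m (Function.extend Subtype.val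 ψ (0 : E4 → ℝ)) (E4.ofTimeSpace 0 y)‖ ^ 2)) y) := by
  sorry

/-! ## Names for the six statements (hypotheses of the composition)

The layer-invariant audit admits, as hypotheses of the theorem that concludes the crux, only registered obligations or the
declared stubs BY NAME; `Statement.stub_x` is the statement of `stub_x` (its `type_of%`) under the stub's own short name, so that
`KappaExplicitWaveDecay_of` can be stated over the six statements and still pass the audit (the obligation-tag attributes
are gate-reserved and cannot be written in a crux workfile). -/

namespace Statement

/-- Statement of `stub_blowupNormalForm`. -/
abbrev stub_blowupNormalForm : Prop := type_of% ExtremalCornerBlowup.stub_blowupNormalForm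
/-- Statement of `stub_coneEstimate` (normal form ⇒ cone estimate). -/
abbrev stub_coneEstimate : Prop := type_of% ExtremalCornerBlowup.stub_coneEstimate
/-- Statement of `stub_offConeEstimate`. -/
abbrev stub_offConeEstimate : Prop := type_of% ExtremalCornerBlowup.stub_offConeEstimate
/-- Statement of `stub_boxWronskian`. -/
abbrev stub_boxWronskian : Prop := type_of% ExtremalCornerBlowup.stub_boxWronskian
/-- Statement of `stub_integratedDecay` (phase space ⇒ (b)). -/
abbrev stub_integratedDecay : Prop := type_of% ExtremalCornerBlowup.stub_integratedDecay
/-- Statement of `stub_boundedness` (phase space + (b) ⇒ (a)). -/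
abbrev stub_boundedness : Prop := type_of% ExtremalCornerBlowup.stub_boundedness

end Statement

/-- **Certificate for S4**: the tree's named fact (TdC 2020 Prop. 6.3, all spins `s ∈ ½ℤ`) gives the registered
stub at `s = 0` — so `stub_boxWronskian` closes the moment `Kerr.Costa2019_wronskianBound_subextremal` is proved
in `Literature/`, and the line is exactly as conditional as that citation until then. -/
theorem boxWronskian_of_fact (h : Kerr.Costa2019_wronskianBound_subextremal) : Statement.stub_boxWronskian := by
  intro M hM
  obtain ⟨G, hG⟩ := h M 0 hM ⟨0, by norm_num⟩
  refine ⟨G, fun C a ω m lam ha hm hω hC RH RI h1 h2 h3 h4 => ?_⟩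
  obtain ⟨k, hk⟩ := hm
  exact hG C a ω m lam ha ⟨k, by rw [hk]; ring⟩ hω hC RH RI h1 h2 h3 h4

/-! ## The composition (kernel-checked, sorry-free) -/

/-- Monotonicity of the `κ`-factor: for a sub-extremal spin `χ = 1 − (a/M)² ∈ (0, 1]`, so `χ^{-p}` is
non-decreasing in `p`. [folklore] -/
theorem kappaFactor_mono {M a : ℝ} (hM : 0 < M) (ha : Kerr.IsSubextremal M a) {p q : ℝ} (hpq : p ≤ q) :
    ENNReal.ofReal ((1 - (a / M) ^ 2) ^ (-p)) ≤ ENNReal.ofReal ((1 - (a / M) ^ 2) ^ (-q)) := by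
  have ha' : |a| < M := ha
  have h1 : |a / M| < 1 := by
    rw [abs_div, abs_of_pos hM]
    exact (div_lt_one hM).mpr ha'
  have h2 : (a / M) ^ 2 < 1 := (sq_lt_one_iff_abs_lt_one (a / M)).mpr h1
  have hχ0 : 0 < 1 - (a / M) ^ 2 := by linarith
  have hχ1 : 1 - (a / M) ^ 2 ≤ 1 := by nlinarith [sq_nonneg (a / M)]
  exact ENNReal.ofReal_le_ofReal (Real.rpow_le_rpow_of_exponent_ge hχ0 hχ1 (neg_le_neg hpq))

/-- Monotonicity of the order-`j` data energy `E_j[ψ](0)` in `j` (more derivatives, larger sum). [folklore] -/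
theorem dataEnergy_mono {M a : ℝ} (ψ : Kerr.exterior M a → ℝ) {j j' : ℕ} (hj : j ≤ j') :
    (∫⁻ y : E3, {y | E4.ofTimeSpace 0 y ∈ Kerr.exterior M a}.indicator (fun y ↦ ENNReal.ofReal
        (∑ m ∈ Finset.range (j + 1), ‖iteratedFDeriv ℝ m (Function.extend Subtype.val ψ (0 : E4 → ℝ))
          (E4.ofTimeSpace 0 y)‖ ^ 2)) y) ≤
      ∫⁻ y : E3, {y | E4.ofTimeSpace 0 y ∈ Kerr.exterior M a}.indicator (fun y ↦ ENNReal.ofReal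
        (∑ m ∈ Finset.range (j' + 1), ‖iteratedFDeriv ℝ m (Function.extend Subtype.val ψ (0 : E4 → ℝ))
          (E4.ofTimeSpace 0 y)‖ ^ 2)) y := by
  refine lintegral_mono fun y ↦ Set.indicator_le_indicator ?_
  refine ENNReal.ofReal_le_ofReal ?_
  exact Finset.sum_le_sum_of_subset_of_nonneg (Finset.range_mono (by omega)) fun _ _ _ ↦ by positivity

/-- **`KappaExplicitWaveDecay_of`** — the six stub STATEMENTS imply the crux, BY NAME. Plumbing plus one real
step: clauses (a) and (b) arrive with their own exponents `(p₁, j₁)`, `(p₂, j₂)`; the crux wants a common pair,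
and `(max p₁ p₂, max j₁ j₂)` works because `χ^{-p}` (`χ = 1 − (a/M)² ∈ (0,1]` on the sub-extremal range) and
`E_j` are monotone (`kappaFactor_mono`, `dataEnergy_mono`). -/
theorem KappaExplicitWaveDecay_of (h₁ : Statement.stub_blowupNormalForm) (h₂ : Statement.stub_coneEstimate)
    (h₃ : Statement.stub_offConeEstimate) (h₄ : Statement.stub_boxWronskian)
    (h₅ : Statement.stub_integratedDecay) (h₆ : Statement.stub_boundedness) :
    KappaExplicitWaveDecay := by
  intro instF instS M hM
  have hcone := h₂ h₁
  -- `@`: keep the instance binders `∀ [Kerr.Facts] [Kerr.SliceFacts]` of clause (b) un-instantiated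
  have hI := @h₅ hcone h₃ h₄
  have hB := h₆ hcone h₃ h₄ @hI
  obtain ⟨p₁, j₁, C₁, hC₁, hbdd⟩ := hB M hM
  obtain ⟨p₂, j₂, hiled⟩ := hI M hM
  refine ⟨max p₁ p₂, max j₁ j₂, ⟨C₁, hC₁, fun a ha ψ hψ τ hτ ↦ ?_⟩, fun R ↦ ?_⟩
  · calc _ ≤ _ := hbdd a ha ψ hψ τ hτ
      _ ≤ _ := mul_le_mul' (mul_le_mul' le_rfl (kappaFactor_mono hM ha (le_max_left _ _)))
          (dataEnergy_mono ψ (le_max_left _ _))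
  · obtain ⟨C₂, hC₂, hh⟩ := hiled R
    refine ⟨C₂, hC₂, fun a ha ψ hψ ↦ ?_⟩
    calc _ ≤ _ := hh a ha ψ hψ
      _ ≤ _ := mul_le_mul' (mul_le_mul' le_rfl (kappaFactor_mono hM ha (le_max_right _ _)))
          (dataEnergy_mono ψ (le_max_right _ _))

/-- The crux along this line, MODULO the six registered stubs (references every `stub_*`, so the skeleton
audit shows exactly which sorries `KappaExplicitWaveDecay` still depends on; the lead closes the crux by
discharging them). -/
theorem KappaExplicitWaveDecay_proof : KappaExplicitWaveDecay :=
  KappaExplicitWaveDecay_of stub_blowupNormalForm stub_coneEstimate stub_offConeEstimate stub_boxWronskian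
    stub_integratedDecay stub_boundedness

end Summit.FinalStateConjecture.FinalStateConjecture.Cruxes.KappaExplicitWaveDecay.ExtremalCornerBlowup
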